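import Mathlib
import Summits.ValiantsHypothesis.ValiantsHypothesis.Theorems.RigidityForcesSymmetryRankRigidMinimalReprLaplaceFiveSeparatedCaptureTwoK2Hub

/-!
# ValiantsHypothesis / RigidityForcesSymmetry — crux `LaplaceOptimalFive` (stmt-ValiantsHypothesis-24813):
# SEPARATED CAPTURE — the profile `2K₂` without side-symmetry — part 2/2: obligations captured, ★ `twoK2`, ★ `twoK2_relabel`

Crux idea #8 `separated-capture` (val-idea-19 g8; `Cruxes/LaplaceOptimalFive/Ideas/separated-capture.md` r4,
`Cruxes/LaplaceOptimalFive/SeparatedCaptureSketch.lean` r4 @8c37d69649eb, memo `SeparatedCaptureLemmaH.md` @c6e1de38a657; referee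
val-idea-crit-3 g5, PASS-WITH-PRICE — this file is the sharpened price P1).

MECHANISM.  On a `{3,4}`-SEPARATED pair profile (short sides among `01, 02, 12 | 34`) contract the exactness identity
`Σ_t u_t ⊗ w_t = P₅` against a leaf matrix `μ` on the slots `{3,4}` that annihilates every `{3,4}`-short factor: the leaf terms die and
the OBLIGATION TENSOR `P₅ ⌞ μ` (a symmetric 3-tensor on the slots `0,1,2`) is CAPTURED by the triangle configuration
`U₀₁ ⊗ V₂ + U₀₂ ⊗ V₁ + U₁₂ ⊗ V₀` of short-factor spans (`obligation_captured`).  Contracting the free slot `2` against `𝟙` (the HUB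
CONTRACTION) maps the ten obligations bijectively onto the symmetric zero-diagonal `5 × 5` matrices — LEMMA W: the pairs-vs-triples
inclusion matrix `W₂₃(5)`, alias the adjacency matrix `A` of the Petersen graph, is nonsingular, `A⁻¹ = (A + I − J/3)/2`
(`hub_injective`, ten explicit linear combinations) — and maps `U₀₁ ⊗ V₂` into `U₀₁`.  Hence, when there are no `02`/`12` terms,
`10 − n₃₄ ≤ dim W ≤ dim U₀₁ ≤ n₀₁` (`capture_one_direction`, `twoK2`): **every split decomposition of `P₅` on the cuts `{0,1}`, `{3,4}`
(any multiplicities, off-shell factors, side-symmetric OR NOT) has at least ten terms, weight `≥ 120`**; `twoK2_relabel` moves it to any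
two disjoint pairs.  To our knowledge the first K1-type kernel theorem WITHOUT the `SideSymmetric` hypothesis (the sum-rigidity census
✓ p662460 … ✓ p672506 is side-symmetric throughout).

HONEST FRAMING.  A SPECIAL CASE only: `LaplaceOptimalFive` (stmt-24813) stays OPEN · CONTESTED 72/120 (the general separated profile
`{01,02,12,34}` is EQUIVALENT to the open 3-slot capture inequality `CaptureIneq` of the sketch; hub profiles are untouched);
`RankRigidMinimalRepr`, the route, and `VP ≠ VNP` are NOT proved.  No `sorry`, no new axioms; Mathlib + tree only.

THIS MODULE: `obligation_captured` (IsSplitDecomposition form), ★ `twoK2` (every split decomposition of `P₅` on the cuts `{0,1}`, `{3,4}` has weight ≥ 120 — no side-symmetry assumed), ★ `twoK2_relabel` (any two disjoint pairs, via ✓ `…LaplaceFiveRelabel`).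

PORT NOTE (val-port-4 g3, desk RULING #358 (A)): this is val-idea-19 g8's crux workfile
`Cruxes/LaplaceOptimalFive/SeparatedCaptureTwoK2.lean` (sha16 f66f20c184baed76, farm rc 0 / 0 sorry / 0 warnings, std axioms) with
(i) the six vocabulary defs `perm5`/`word`/`contractZ`/`L3`/`short2`/`shortSpan` taken BY NAME from ✓ `…LaplaceFiveSeparatedCaptureDefs`
(byte-identical bodies, same namespace — proofs unchanged), (ii) the 400-line split `…TwoK2Hub` (Lemma W + one-direction capture) →
`…TwoK2` (obligations captured + the theorem), (iii) five docstrings added.  Proof texts VERBATIM.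
-/

set_option linter.dupNamespace false
set_option autoImplicit false

namespace Summit.ValiantsHypothesis.ValiantsHypothesis.Theorems.RigidityForcesSymmetryRankRigidMinimalRepr

namespace LaplaceFiveSeparatedCapture

open Finset LaplaceFiveSectorSplit

set_option maxHeartbeats 1600000 in
/-- **Obligations are captured** (`IsSplitDecomposition` form): on a {3,4}-separated pair profile every obligation tensor `P₅ ⌞ μ`, `μ` annihilating the leaf short factors, lies in `L3` of the triangle short spans. [folklore] -/
theorem obligation_captured {N : ℕ} (T : Finset (Fin N)) (S : Fin N → Finset (Fin 5))
    (u w : Fin N → (Fin 5 → Fin 5) → ℂ) (hdec : IsSplitDecomposition T S u w)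
    (hsep : ∀ t ∈ T, S t = ({0, 1} : Finset (Fin 5)) ∨ S t = ({0, 2} : Finset (Fin 5)) ∨
      S t = ({1, 2} : Finset (Fin 5)) ∨ S t = ({3, 4} : Finset (Fin 5)))
    (μ : Fin 5 → Fin 5 → ℂ)
    (hμ : ∀ t ∈ T, S t = ({3, 4} : Finset (Fin 5)) → (∑ s : Fin 5, ∑ s' : Fin 5, μ s s' * short2 (u t) 3 4 s s') = 0) :
    contractZ μ ∈ L3 (shortSpan T S u 0 1) (shortSpan T S u 0 2) (shortSpan T S u 1 2) := by
  classical
  have hex : ∀ v : Fin 5 → Fin 5, (∑ t ∈ T, u t v * w t v) = perm5 v := hdec.2.2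
  -- short factors through `short2` (cylindricity of `u`)
  have hu01 : ∀ t, S t = ({0, 1} : Finset (Fin 5)) → ∀ p q r s t' : Fin 5,
      u t (word p q r s t') = short2 (u t) 0 1 p q := by
    intro t hS p q r s t'
    apply hdec.1 t
    intro i hi
    rw [hS] at hi
    simp only [Finset.mem_insert, Finset.mem_singleton] at hi
    rcases hi with rfl | rfl <;> simp [word]
  have hu02 : ∀ t, S t = ({0, 2} : Finset (Fin 5)) → ∀ p q r s t' : Fin 5,
      u t (word p q r s t') = short2 (u t) 0 2 p r := by
    intro t hS p q r s t'
    apply hdec.1 t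
    intro i hi
    rw [hS] at hi
    simp only [Finset.mem_insert, Finset.mem_singleton] at hi
    rcases hi with rfl | rfl <;> simp [word]
  have hu12 : ∀ t, S t = ({1, 2} : Finset (Fin 5)) → ∀ p q r s t' : Fin 5,
      u t (word p q r s t') = short2 (u t) 1 2 q r := by
    intro t hS p q r s t'
    apply hdec.1 t
    intro i hi
    rw [hS] at hi
    simp only [Finset.mem_insert, Finset.mem_singleton] at hi
    rcases hi with rfl | rfl <;> simp [word]
  have hu34 : ∀ t, S t = ({3, 4} : Finset (Fin 5)) → ∀ p q r s t' : Fin 5,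
      u t (word p q r s t') = short2 (u t) 3 4 s t' := by
    intro t hS p q r s t'
    apply hdec.1 t
    intro i hi
    rw [hS] at hi
    simp only [Finset.mem_insert, Finset.mem_singleton] at hi
    rcases hi with rfl | rfl <;> simp [word]
  -- long factors forget the short slots (cylindricity of `w`)
  have hw01 : ∀ t, S t = ({0, 1} : Finset (Fin 5)) → ∀ p q r s t' : Fin 5,
      w t (word p q r s t') = w t (word 0 0 r s t') := by
    intro t hS p q r s t'
    apply hdec.2.1 t
    intro i hi
    rw [hS] at hi
    fin_cases i <;> simp [word] at hi ⊢
  have hw02 : ∀ t, S t = ({0, 2} : Finset (Fin 5)) → ∀ p q r s t' : Fin 5,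
      w t (word p q r s t') = w t (word 0 q 0 s t') := by
    intro t hS p q r s t'
    apply hdec.2.1 t
    intro i hi
    rw [hS] at hi
    fin_cases i <;> simp [word] at hi ⊢
  have hw12 : ∀ t, S t = ({1, 2} : Finset (Fin 5)) → ∀ p q r s t' : Fin 5,
      w t (word p q r s t') = w t (word p 0 0 s t') := by
    intro t hS p q r s t'
    apply hdec.2.1 t
    intro i hi
    rw [hS] at hi
    fin_cases i <;> simp [word] at hi ⊢
  have hw34 : ∀ t, S t = ({3, 4} : Finset (Fin 5)) → ∀ p q r s t' : Fin 5,
      w t (word p q r s t') = w t (word p q r 0 0) := by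
    intro t hS p q r s t'
    apply hdec.2.1 t
    intro i hi
    rw [hS] at hi
    fin_cases i <;> simp [word] at hi ⊢
  -- the obligation tensor is the sum of the per-term contractions
  have key : contractZ μ = ∑ t ∈ T,
      (fun p q r => ∑ s : Fin 5, ∑ t' : Fin 5, μ s t' * (u t (word p q r s t') * w t (word p q r s t'))) := by
    funext p q r
    simp only [Finset.sum_apply, contractZ, ← hex, Finset.mul_sum]
    symm
    rw [Finset.sum_comm]
    refine Finset.sum_congr rfl (fun s _ => ?_)
    rw [Finset.sum_comm]
  rw [key]
  refine Submodule.sum_mem _ (fun t ht => ?_)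
  rcases hsep t ht with h01 | h02 | h12 | h34
  · -- cut 01 | 234 : contributes `short2 (u t) 0 1 ⊗ (w t ⌞ μ)` on slots (0,1) × 2
    have hmem : short2 (u t) 0 1 ∈ shortSpan T S u 0 1 :=
      Submodule.subset_span ⟨t, ⟨ht, h01⟩, rfl⟩
    have hF : (fun p q r => ∑ s : Fin 5, ∑ t' : Fin 5, μ s t' * (u t (word p q r s t') * w t (word p q r s t')))
        = fun p q r => short2 (u t) 0 1 p q * (∑ s : Fin 5, ∑ t' : Fin 5, μ s t' * w t (word 0 0 r s t')) := by
      funext p q r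
      rw [Finset.mul_sum]
      refine Finset.sum_congr rfl (fun s _ => ?_)
      rw [Finset.mul_sum]
      refine Finset.sum_congr rfl (fun t' _ => ?_)
      rw [hu01 t h01 p q r s t', hw01 t h01 p q r s t']
      ring
    rw [hF]
    apply Submodule.subset_span
    simp only [Set.mem_union, Set.mem_setOf_eq]
    exact Or.inl (Or.inl ⟨short2 (u t) 0 1, hmem, _, rfl⟩)
  · -- cut 02 | 134
    have hmem : short2 (u t) 0 2 ∈ shortSpan T S u 0 2 :=
      Submodule.subset_span ⟨t, ⟨ht, h02⟩, rfl⟩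
    have hF : (fun p q r => ∑ s : Fin 5, ∑ t' : Fin 5, μ s t' * (u t (word p q r s t') * w t (word p q r s t')))
        = fun p q r => short2 (u t) 0 2 p r * (∑ s : Fin 5, ∑ t' : Fin 5, μ s t' * w t (word 0 q 0 s t')) := by
      funext p q r
      rw [Finset.mul_sum]
      refine Finset.sum_congr rfl (fun s _ => ?_)
      rw [Finset.mul_sum]
      refine Finset.sum_congr rfl (fun t' _ => ?_)
      rw [hu02 t h02 p q r s t', hw02 t h02 p q r s t']
      ring
    rw [hF]
    apply Submodule.subset_span
    simp only [Set.mem_union, Set.mem_setOf_eq]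
    exact Or.inl (Or.inr ⟨short2 (u t) 0 2, hmem, _, rfl⟩)
  · -- cut 12 | 034
    have hmem : short2 (u t) 1 2 ∈ shortSpan T S u 1 2 :=
      Submodule.subset_span ⟨t, ⟨ht, h12⟩, rfl⟩
    have hF : (fun p q r => ∑ s : Fin 5, ∑ t' : Fin 5, μ s t' * (u t (word p q r s t') * w t (word p q r s t')))
        = fun p q r => short2 (u t) 1 2 q r * (∑ s : Fin 5, ∑ t' : Fin 5, μ s t' * w t (word p 0 0 s t')) := by
      funext p q r
      rw [Finset.mul_sum]
      refine Finset.sum_congr rfl (fun s _ => ?_)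
      rw [Finset.mul_sum]
      refine Finset.sum_congr rfl (fun t' _ => ?_)
      rw [hu12 t h12 p q r s t', hw12 t h12 p q r s t']
      ring
    rw [hF]
    apply Submodule.subset_span
    simp only [Set.mem_union, Set.mem_setOf_eq]
    exact Or.inr ⟨short2 (u t) 1 2, hmem, _, rfl⟩
  · -- leaf cut 34 | 012 : killed by `hμ`
    have hF : (fun p q r => ∑ s : Fin 5, ∑ t' : Fin 5, μ s t' * (u t (word p q r s t') * w t (word p q r s t')))
        = 0 := by
      funext p q r
      simp only [Pi.zero_apply]
      have : ∀ s t' : Fin 5, μ s t' * (u t (word p q r s t') * w t (word p q r s t'))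
          = (μ s t' * short2 (u t) 3 4 s t') * w t (word p q r 0 0) := by
        intro s t'
        rw [hu34 t h34 p q r s t', hw34 t h34 p q r s t']
        ring
      simp only [this, ← Finset.sum_mul, hμ t ht h34, zero_mul]
    rw [hF]
    exact Submodule.zero_mem _

set_option maxHeartbeats 1600000 in
/-- **`LaplaceOptimalFive` on the profile `2K₂ = {01, 34}` WITHOUT side-symmetry** (any multiplicities, off-shell factors allowed,
both young-shadow sectors): every split decomposition of `P₅` whose short sides are `{0,1}` or `{3,4}` has Laplace weight `≥ 120`, i.e.
at least ten terms.  Proof: the symmetric zero-diagonal leaf matrices annihilating the `{3,4}`-short factors form a space `W` with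
`dim W ≥ 10 − n₃₄` (rank–nullity on the `ℂ¹⁰` chart), every obligation `P₅ ⌞ μ, μ ∈ W` is captured by `U₀₁ ⊗ V₂`
(`obligation_captured`), and the one-direction capture inequality (`capture_one_direction`: hub contraction + Lemma W) gives
`10 − n₃₄ ≤ dim W ≤ m₀₁ ≤ n₀₁`. [new] -/
theorem twoK2 {N : ℕ} (T : Finset (Fin N)) (S : Fin N → Finset (Fin 5)) (u w : Fin N → (Fin 5 → Fin 5) → ℂ)
    (hdec : IsSplitDecomposition T S u w)
    (hC : ∀ t ∈ T, S t = ({0, 1} : Finset (Fin 5)) ∨ S t = ({3, 4} : Finset (Fin 5))) :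
    Nat.factorial 5 ≤ laplaceWeight T S := by
  classical
  have hsep : ∀ t ∈ T, S t = ({0, 1} : Finset (Fin 5)) ∨ S t = ({0, 2} : Finset (Fin 5)) ∨
      S t = ({1, 2} : Finset (Fin 5)) ∨ S t = ({3, 4} : Finset (Fin 5)) :=
    fun t ht => (hC t ht).elim Or.inl (fun h => Or.inr (Or.inr (Or.inr h)))
  -- no terms on the cuts 02, 12: those short spans vanish
  have hbot : ∀ a b : Fin 5, ({a, b} : Finset (Fin 5)) ≠ {0, 1} → ({a, b} : Finset (Fin 5)) ≠ {3, 4} →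
      shortSpan T S u a b = ⊥ := by
    intro a b h1 h2
    unfold shortSpan
    rw [Submodule.span_eq_bot]
    rintro x ⟨t, ⟨ht, hSt⟩, rfl⟩
    exfalso
    rcases hC t ht with h | h
    · exact h1 (hSt ▸ h)
    · exact h2 (hSt ▸ h)
  have h02bot : shortSpan T S u 0 2 = ⊥ := hbot 0 2 (by decide) (by decide)
  have h12bot : shortSpan T S u 1 2 = ⊥ := hbot 1 2 (by decide) (by decide)
  /- (1) the profile is made of pair cuts: weight = 12·|T| and the four cut classes are disjoint in T -/
  have hweight : laplaceWeight T S = 12 * T.card := by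
    unfold laplaceWeight
    rw [Finset.sum_congr rfl (g := fun _ => 12) ?_]
    · simp [mul_comm]
    · intro t ht
      rcases hsep t ht with h | h | h | h <;> rw [h] <;> decide
  have hcount :
      (T.filter (fun t => S t = ({0, 1} : Finset (Fin 5)))).card
        + (T.filter (fun t => S t = ({0, 2} : Finset (Fin 5)))).card
        + (T.filter (fun t => S t = ({1, 2} : Finset (Fin 5)))).card
        + (T.filter (fun t => S t = ({3, 4} : Finset (Fin 5)))).card ≤ T.card := by
    rw [Finset.card_filter, Finset.card_filter, Finset.card_filter, Finset.card_filter,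
      ← Finset.sum_add_distrib, ← Finset.sum_add_distrib, ← Finset.sum_add_distrib, Finset.card_eq_sum_ones T]
    apply Finset.sum_le_sum
    intro t ht
    rcases hsep t ht with h | h | h | h <;> rw [h] <;> decide
  /- (2) spans are at most as big as the number of terms on the cut -/
  have hm : ∀ a b : Fin 5, Module.finrank ℂ (shortSpan T S u a b)
      ≤ (T.filter (fun t => S t = ({a, b} : Finset (Fin 5)))).card := by
    intro a b
    have hset : ((fun t => short2 (u t) a b) '' {t : Fin N | t ∈ T ∧ S t = ({a, b} : Finset (Fin 5))})
        = (((T.filter (fun t => S t = ({a, b} : Finset (Fin 5)))).image (fun t => short2 (u t) a b) :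
            Finset (Fin 5 → Fin 5 → ℂ)) : Set (Fin 5 → Fin 5 → ℂ)) := by
      ext x
      simp
    unfold shortSpan
    rw [hset]
    exact (finrank_span_finset_le_card _).trans Finset.card_image_le
  /- (3) coordinates for the symmetric zero-diagonal leaf matrices: an injective linear chart from ℂ^{10} -/
  let P := {x : Fin 5 × Fin 5 // x.1 < x.2}
  have hP : Fintype.card P = 10 := by decide
  let LsymFun : (P → ℂ) → (Fin 5 → Fin 5 → ℂ) := fun c s t =>
    if h : s < t then c ⟨(s, t), h⟩ else if h' : t < s then c ⟨(t, s), h'⟩ else 0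
  let Lsym : (P → ℂ) →ₗ[ℂ] (Fin 5 → Fin 5 → ℂ) :=
    { toFun := LsymFun
      map_add' := by
        intro c c'
        funext s t
        simp only [LsymFun, Pi.add_apply]
        split_ifs <;> simp
      map_smul' := by
        intro r c
        funext s t
        simp only [LsymFun, Pi.smul_apply, smul_eq_mul, RingHom.id_apply]
        split_ifs <;> simp }
  have hLsym_apply : ∀ c s t, Lsym c s t = LsymFun c s t := fun _ _ _ => rfl
  have hinj : Function.Injective Lsym := by
    intro c c' h
    funext π
    have := congr_fun (congr_fun h π.1.1) π.1.2
    simpa [hLsym_apply, LsymFun, π.2] using this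
  have hsym : ∀ c (s t : Fin 5), Lsym c s t = Lsym c t s := by
    intro c s t
    simp only [hLsym_apply, LsymFun]
    rcases lt_trichotomy s t with h | rfl | h
    · simp [h, not_lt.mpr h.le]
    · simp
    · simp [h, not_lt.mpr h.le]
  have hdiag : ∀ c (s : Fin 5), Lsym c s s = 0 := by
    intro c s
    simp [hLsym_apply, LsymFun]
  /- (4) the leaf evaluation map and its kernel (rank–nullity: dim ker ≥ 10 − n₃₄) -/
  let ev : (Fin 5 → Fin 5 → ℂ) →ₗ[ℂ] ((T.filter (fun t => S t = ({3, 4} : Finset (Fin 5)))) → ℂ) :=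
    { toFun := fun M t => ∑ s : Fin 5, ∑ s' : Fin 5, M s s' * short2 (u t.1) 3 4 s s'
      map_add' := by
        intro M M'
        funext t
        simp only [Pi.add_apply, add_mul, Finset.sum_add_distrib]
      map_smul' := by
        intro r M
        funext t
        simp only [Pi.smul_apply, smul_eq_mul, RingHom.id_apply, Finset.mul_sum, mul_assoc] }
  have hev_apply : ∀ M t, ev M t = ∑ s : Fin 5, ∑ s' : Fin 5, M s s' * short2 (u t.1) 3 4 s s' :=
    fun _ _ => rfl
  let ev' : (P → ℂ) →ₗ[ℂ] ((T.filter (fun t => S t = ({3, 4} : Finset (Fin 5)))) → ℂ) := ev ∘ₗ Lsym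
  have hrn := LinearMap.finrank_range_add_finrank_ker ev'
  rw [Module.finrank_fintype_fun_eq_card, hP] at hrn
  have hrange : Module.finrank ℂ (LinearMap.range ev')
      ≤ (T.filter (fun t => S t = ({3, 4} : Finset (Fin 5)))).card := by
    have := Submodule.finrank_le (LinearMap.range ev')
    rwa [Module.finrank_fintype_fun_eq_card, Fintype.card_coe] at this
  /- (5) the captured space W := Lsym (ker ev') and the capture inequality -/
  have hWK : Module.finrank ℂ ((LinearMap.ker ev').map Lsym) = Module.finrank ℂ (LinearMap.ker ev') :=
    (LinearEquiv.finrank_eq (Submodule.equivMapOfInjective Lsym hinj (LinearMap.ker ev'))).symm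
  have hcapW : Module.finrank ℂ ((LinearMap.ker ev').map Lsym)
      ≤ Module.finrank ℂ (shortSpan T S u 0 1) + Module.finrank ℂ (shortSpan T S u 0 2)
        + Module.finrank ℂ (shortSpan T S u 1 2) := by
    apply capture_one_direction _ _ _ _ h02bot h12bot
    · intro μ hμ s t
      obtain ⟨c, -, rfl⟩ := Submodule.mem_map.1 hμ
      exact hsym c s t
    · intro μ hμ s
      obtain ⟨c, -, rfl⟩ := Submodule.mem_map.1 hμ
      exact hdiag c s
    · intro μ hμ
      obtain ⟨c, hcK, rfl⟩ := Submodule.mem_map.1 hμ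
      apply obligation_captured T S u w hdec hsep
      intro t ht h34
      have h0 := congr_fun (LinearMap.mem_ker.1 hcK) ⟨t, Finset.mem_filter.2 ⟨ht, h34⟩⟩
      rw [Pi.zero_apply] at h0
      simpa [ev', hev_apply] using h0
  /- (6) count -/
  have h01 := hm 0 1
  have h02 := hm 0 2
  have h12 := hm 1 2
  have h5 : Nat.factorial 5 = 120 := by decide
  rw [h5, hweight]
  omega

/-- `twoK2` on any placement: short sides `{π 0, π 1}` or `{π 3, π 4}` for a slot permutation `π` (two disjoint pairs). [new] -/
theorem twoK2_relabel {N : ℕ} (T : Finset (Fin N)) (S : Fin N → Finset (Fin 5)) (u w : Fin N → (Fin 5 → Fin 5) → ℂ)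
    (hdec : IsSplitDecomposition T S u w) (π : Equiv.Perm (Fin 5))
    (hC : ∀ t ∈ T, S t = ({π 0, π 1} : Finset (Fin 5)) ∨ S t = ({π 3, π 4} : Finset (Fin 5))) :
    Nat.factorial 5 ≤ laplaceWeight T S := by
  rw [← LaplaceFiveRelabel.laplaceWeight_relabel T S π.symm]
  refine twoK2 T _ _ _ (LaplaceFiveRelabel.isSplitDecomposition_relabel T S u w π.symm hdec) ?_
  intro t ht
  rcases hC t ht with h | h
  · left
    show (S t).image ⇑π.symm = _
    rw [h, LaplaceFiveRelabel.image_pair]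
    simp
  · right
    show (S t).image ⇑π.symm = _
    rw [h, LaplaceFiveRelabel.image_pair]
    simp


end LaplaceFiveSeparatedCapture

end Summit.ValiantsHypothesis.ValiantsHypothesis.Theorems.RigidityForcesSymmetryRankRigidMinimalRepr
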